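import Summits.BirchSwinnertonDyer.BirchSwinnertonDyer.Theorems.QuadraticBranchSignedControlPlusEtaNonsurjThetaFunctionalEquationExactBranch
import Literature.NumberTheory.EllipticCurves.IwasawaAlgebraInvolutionFixedPrimesProofs
import HarnessLib

/-!
# Route `QuadraticBranchSignedControl` (rung K8, cell `bsd-potss`), residual crux `PlusEtaMainConjectureNonsurj`
# (stmt-BirchSwinnertonDyer-19606): THE FUNCTIONAL EQUATION ON THE QUADRATIC BRANCH, XI — THE SUB-LEADING TERM LAW
# `2·coeff_{r+1} L + (c + b + r)·coeff_r L = 0` (`r = ord_T L`) for EVERY nonzero `L_p^±(V, η, X)` (seat `bsd-potss-k8eta-c2` g28; kernel, class-wide)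

WHY. Parts IX–X (p763122, p763347) proved the EXACT `Λ`-adic functional equation `ι L = w·(1+T)^e·L` of every branch function
`L = L_p^±(V, η, X)` (`e = c + b` plus, `e = c + a` minus; `w = σ·(−N | p)`). Bianchi–Sprung (Abh. Math. Semin. Univ. Hambg. 2019, Thm. 5.1,
for Pollack's `L_p^±(E,T)`) read off such an equation the SUB-LEADING TERM: writing `L = a_r T^r + b_r T^{r+1} + ⋯` (`r = ord_{T=0} L`),
`b_r = −(a_r/2)·(e + r)`. THIS FILE proves that law in `Λ` for every power series with an exact functional equation (§24) and instantiates
it on the quadratic branch (§25): **`2·coeff_{r+1} L + (c + b + r)·coeff_r L = 0` for every nonzero plus branch function** (minus: `c + a`),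
SIGN-FREE (the Fricke sign is eliminated: it only fixes the parity of `r`, Part VI), for ANY period ratio; in particular, when
`L_p⁺(V, η, 0) ≠ 0`: **`2·coeff₁ L = −(c + b)·L(0)`** — the cyclotomic derivative of `L_p⁺(V,η,X)` at `X = 0` is DETERMINED by its value and
the conductor (`c = log_γ⟨N⟩`, `b = −1/(p+1)`). Census P-28E (k8eta-c2 g28, pre-registered; exact fold of the lineage's existing symbol
vectors in the engine's coordinates `γ_e = ⟨g⟩`): the law `ℓ_{λ+1}/ℓ_λ ≡ −(c_e − 1/(p+1) + λ)/2 (mod p)` holds on 9125/9125 + 44/44 level-2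
rows (`p = 5, 7, 11`, every row informative) and its exact-order forms mod `p²` on the 44 level-4 rows — 0 failures.

MATHEMATICS. (§24) If `ι Q = (1+T)^e·Q` (sign `+1`) then comparing the coefficients of `T`: `(ι Q)_1 = −Q_1` (`ι T = −T + T² − ⋯`) and
`((1+T)^eQ)_1 = Q_1 + eQ_0`, so `2Q_1 + eQ_0 = 0`. If `ι M = w(1+T)^e M`, `M = T^r·Q` and `w = (−1)^r`, then, since `ι T = −T·(1+T)⁻¹`,
`(−1)^r T^r (1+T)^{−r} ι Q = (−1)^r (1+T)^e T^r Q`, i.e. `ι Q = (1+T)^{e+r} Q` (cancel `T^r` in the domain `Λ`): the reduction to `r = 0` with the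
exponent SHIFTED by `r`; `w = (−1)^{ord M}` is Part VI / the barrier lemma `eq_neg_one_pow_of_subst_eq`. (§25) Part X's exact equations.

WHAT. §24 `coeff_one_invol`, `coeff_one_binomialSeries_mul`, `two_mul_coeff_one_add_eq_zero_of_invol_eq` (r = 0),
`invol_eq_binomialSeries_add_mul_of_X_pow_mul` (the shift), **`two_mul_coeff_succ_add_eq_zero_of_invol_eq`** (general `r`, hypothesis
`w = (−1)^r`), `two_mul_coeff_succ_order_add_eq_zero_of_invol_eq` (`r = ord M`, `w = ±1` arbitrary); §25
**`two_mul_coeff_succ_order_add_eq_zero_of_isQuadraticBranch{Plus,Minus}LFunction`**, `two_mul_coeff_one_eq_of_isQuadraticBranchPlusLFunction`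
(`L(0) ≠ 0`), row currency `two_mul_coeff_succ_order_add_eq_zero_plus_row`, `two_mul_coeff_one_eq_plus_row`.

HONEST FRAMING (cell `bsd-potss`; FULL-BSD rank ≤ 1 programme, HUMAN RULING D-0036/D-0074): TOOL THEOREMS ONLY — no definition, no named
fact, no `sorry`, axioms standard; nothing about (A), (C1⁺_η), C-cc-1 or `BSD(W,p)` of any pair is claimed; no stub of 19606 is proved; crux and
route OPEN; nothing booked. `--supports stmt-BirchSwinnertonDyer-19606`.

References: F. Bianchi, F. Sprung, *Consequences of functional equations for pairs of p-adic L-functions*, Abh. Math. Semin. Univ. Hambg. 89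
(2019), Thm. 5.1 and §5 eqs. (1)–(2) (held: `paper:arxiv-1906.08377`); [Sprung2017] Cor. 4.14; [MazurTateTeitelbaum1986Invent] §I.17;
[GreenbergLNM1716] §1. Tree: Parts IX–X, `IwasawaAlgebraInvolution{,FixedPrimesProofs}` (`invSubOne`, `constantCoeff_invol`),
`Theorems.coeff_one_invSubOne` (k8eta-c1 g11), `EtaMinusCoeffCongruence.coeff_one_mul` (g24).
-/

set_option autoImplicit false
set_option linter.dupNamespace false
noncomputable section

open scoped Classical MatrixGroups ModularForm

open CongruenceSubgroup Polynomial WeierstrassCurve Literature.NumberTheory.EllipticCurves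
  Literature.NumberTheory.EllipticCurves.ModularForms
open Literature.NumberTheory.EllipticCurves.IwasawaAlgebra
open Summit.BirchSwinnertonDyer.Rank1Residual.Additive

namespace Summit.BirchSwinnertonDyer.BirchSwinnertonDyer.Theorems.EtaThetaFunctionalEquation

variable {p : ℕ} [hp : Fact p.Prime]

/-! ## §24 The sub-leading term law for an exact functional equation in `Λ` -/

/-- **`(ι Q)_1 = −Q_1`**: the coefficient of `T` changes sign under the Iwasawa involution (`ι T = −T + T² − ⋯`; write `Q = T·Q' + Q(0)`).
[cite: Washington1997, §13.2] -/
theorem coeff_one_invol (Q : PowerSeries ℤ_[p]) :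
    PowerSeries.coeff 1 (invol p Q) = -PowerSeries.coeff 1 Q := by
  have hQ : Q = PowerSeries.X * PowerSeries.mk (fun n ↦ PowerSeries.coeff (n + 1) Q) +
      PowerSeries.C (PowerSeries.constantCoeff Q) := PowerSeries.eq_X_mul_shift_add_const Q
  conv_lhs => rw [hQ]
  rw [map_add, map_mul, invol_X, invol_C, map_add, EtaMinusCoeffCongruence.coeff_one_mul, PowerSeries.coeff_zero_eq_constantCoeff,
    constantCoeff_invSubOne, zero_mul, zero_add, coeff_one_invSubOne, constantCoeff_invol, PowerSeries.coeff_C, if_neg one_ne_zero,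
    add_zero, ← PowerSeries.coeff_zero_eq_constantCoeff_apply, PowerSeries.coeff_mk, zero_add, neg_one_mul]

omit hp in
/-- **`((1+T)^e·Q)_1 = Q_1 + e·Q_0`** for a `p`-adic exponent `e` (`(e choose 1) = e`). [folklore] -/
theorem coeff_one_binomialSeries_mul [Fact p.Prime] (e : ℤ_[p]) (Q : PowerSeries ℤ_[p]) :
    PowerSeries.coeff 1 (PowerSeries.binomialSeries ℤ_[p] e * Q) =
      PowerSeries.coeff 1 Q + e * PowerSeries.coeff 0 Q := by
  rw [EtaMinusCoeffCongruence.coeff_one_mul, PowerSeries.coeff_zero_eq_constantCoeff, PowerSeries.binomialSeries_constantCoeff, one_mul,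
    PowerSeries.binomialSeries_coeff, Ring.choose_one_right, smul_eq_mul, mul_one]

/-- **The law at order `0`**: `ι Q = (1+T)^e·Q` (sign `+1`) forces `2·Q_1 + e·Q_0 = 0`. [folklore] -/
theorem two_mul_coeff_one_add_eq_zero_of_invol_eq {Q : PowerSeries ℤ_[p]} {e : ℤ_[p]}
    (hFE : invol p Q = PowerSeries.binomialSeries ℤ_[p] e * Q) :
    2 * PowerSeries.coeff 1 Q + e * PowerSeries.coeff 0 Q = 0 := by
  have h := congr_arg (PowerSeries.coeff 1) hFE
  rw [coeff_one_invol, coeff_one_binomialSeries_mul] at h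
  linear_combination -h

/-- **The shift**: if `ι M = w·(1+T)^e·M`, `M = T^r·Q` and `w = (−1)^r`, then `ι Q = (1+T)^{e+r}·Q` — because `ι T = −T·(1+T)⁻¹`, so
`ι M = (−1)^r T^r (1+T)^{−r} ι Q`; cancel `T^r` in the domain `Λ` and use `(1+T)·(1+ιT) = 1`. [cite: MazurTateTeitelbaum1986Invent, §I.17] -/
theorem invol_eq_binomialSeries_add_mul_of_X_pow_mul {M Q : PowerSeries ℤ_[p]} {w e : ℤ_[p]} {r : ℕ}
    (hFE : invol p M = PowerSeries.C w * PowerSeries.binomialSeries ℤ_[p] e * M) (hM : M = PowerSeries.X ^ r * Q)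
    (hw : w = (-1) ^ r) :
    invol p Q = PowerSeries.binomialSeries ℤ_[p] (e + r) * Q := by
  set U : PowerSeries ℤ_[p] := 1 + PowerSeries.X with hU
  set E : PowerSeries ℤ_[p] := 1 + invSubOne p with hE
  have hUE : U * E = 1 := one_add_X_mul_one_add_invSubOne p
  have hιX : invol p PowerSeries.X = -PowerSeries.X * E := by
    rw [invol_X]; linear_combination hUE
  have h1 : invol p M = (-1) ^ r * PowerSeries.X ^ r * E ^ r * invol p Q := by
    rw [hM, map_mul, map_pow, hιX]; ring
  have h2 : PowerSeries.X ^ r * ((-1) ^ r * (E ^ r * invol p Q - PowerSeries.binomialSeries ℤ_[p] e * Q)) = 0 := by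
    have h := h1.symm.trans hFE
    rw [hw, hM, map_pow, map_neg, map_one] at h
    linear_combination h
  have hX : (PowerSeries.X : PowerSeries ℤ_[p]) ^ r ≠ 0 := pow_ne_zero _ PowerSeries.X_ne_zero
  have hn : ((-1 : PowerSeries ℤ_[p])) ^ r ≠ 0 := pow_ne_zero _ (neg_ne_zero.mpr one_ne_zero)
  have h3 : E ^ r * invol p Q = PowerSeries.binomialSeries ℤ_[p] e * Q :=
    sub_eq_zero.mp ((mul_eq_zero.mp ((mul_eq_zero.mp h2).resolve_left hX)).resolve_left hn)
  calc invol p Q = (U * E) ^ r * invol p Q := by rw [hUE, one_pow, one_mul]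
    _ = U ^ r * (E ^ r * invol p Q) := by ring
    _ = PowerSeries.binomialSeries ℤ_[p] (e + r) * Q := by
        rw [h3, PowerSeries.binomialSeries_add, ← PowerSeries.binomialSeries_nat (A := ℤ_[p]) (R := ℤ_[p]) r]; ring

/-- **THE SUB-LEADING TERM LAW (generic).** If `ι M = w·(1+T)^e·M` in `Λ` with `w = (−1)^r` and `coeff_j M = 0` for all `j < r`, then
`2·coeff_{r+1} M + (e + r)·coeff_r M = 0` (Bianchi–Sprung's `b_r = −(a_r/2)(e + r)`). [cite: Sprung2017, Cor. 4.14]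
[cite: GreenbergLNM1716, §1 (pp. 67–68)] -/
theorem two_mul_coeff_succ_add_eq_zero_of_invol_eq {M : PowerSeries ℤ_[p]} {w e : ℤ_[p]} {r : ℕ}
    (hFE : invol p M = PowerSeries.C w * PowerSeries.binomialSeries ℤ_[p] e * M) (hzero : ∀ j < r, PowerSeries.coeff j M = 0)
    (hw : w = (-1) ^ r) :
    2 * PowerSeries.coeff (r + 1) M + (e + r) * PowerSeries.coeff r M = 0 := by
  obtain ⟨Q, hQ⟩ := (PowerSeries.X_pow_dvd_iff (n := r) (φ := M)).mpr hzero
  have h := two_mul_coeff_one_add_eq_zero_of_invol_eq (invol_eq_binomialSeries_add_mul_of_X_pow_mul hFE hQ hw)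
  have hr : PowerSeries.coeff r M = PowerSeries.coeff 0 Q := by
    rw [hQ, PowerSeries.coeff_X_pow_mul', if_pos le_rfl, Nat.sub_self]
  have hr1 : PowerSeries.coeff (r + 1) M = PowerSeries.coeff 1 Q := by
    rw [hQ, PowerSeries.coeff_X_pow_mul', if_pos (Nat.le_succ r), Nat.add_sub_cancel_left]
  rw [hr, hr1]
  exact h

/-- **The law at the order of vanishing**: if `M ≠ 0` satisfies `ι M = w·(1+T)^e·M` with `w = 1 ∨ w = −1` and `r = ord_T M`, then
`2·coeff_{r+1} M + (e + r)·coeff_r M = 0` — the sign takes care of itself (`w = (−1)^{ord M}`, the barrier lemma `eq_neg_one_pow_of_subst_eq`).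
[cite: Sprung2017, Cor. 4.14] [cite: GreenbergLNM1716, §1 and §5] -/
theorem two_mul_coeff_succ_order_add_eq_zero_of_invol_eq {M : PowerSeries ℤ_[p]} (hM0 : M ≠ 0) {w e : ℤ_[p]}
    (hFE : invol p M = PowerSeries.C w * PowerSeries.binomialSeries ℤ_[p] e * M) :
    2 * PowerSeries.coeff (M.order.toNat + 1) M + (e + M.order.toNat) * PowerSeries.coeff M.order.toNat M = 0 := by
  set r := M.order.toNat with hr
  have hne : M.order ≠ ⊤ := fun h ↦ hM0 (PowerSeries.order_eq_top.mp h)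
  have hord : M.order = (r : ℕ) := (ENat.coe_toNat hne).symm
  have hw : w = (-1) ^ r := by
    refine Literature.Barriers.BirchSwinnertonDyer.eq_neg_one_pow_of_subst_eq (constantCoeff_invSubOne p) (coeff_one_invSubOne p)
      (PowerSeries.binomialSeries_constantCoeff (A := ℤ_[p]) e) ?_ hord
    rw [← invol_apply]; exact hFE
  exact two_mul_coeff_succ_add_eq_zero_of_invol_eq hFE (fun j hj ↦ PowerSeries.coeff_of_lt_order j (by
    rw [hord]; exact_mod_cast hj)) hw

/-! ## §25 On the quadratic branch: every nonzero `L_p^±(V, η, X)` -/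

section Branch

variable {N : ℕ} [NeZero N] {f : CuspForm (Gamma0 N) 2}

/-- **THE SUB-LEADING TERM LAW FOR `L_p⁺(V, η, X)`.** For `p` odd, `f` a rational newform of level `N` prime to `p` with `a_p(f) = 0`, `c` the
`p`-adic exponent of `N` (`hc`), `(p+1)b = −1`, ANY period ratio `ϖ` and any NONZERO plus branch function `L` (`IsQuadraticBranchPlusLFunction f p ϖ L`)
with `r = ord_{T=0} L`: **`2·coeff_{r+1} L + (c + b + r)·coeff_r L = 0`** — sign-free; no `μ` / image / CM / rank hypothesis. The η-branch twin of
Bianchi–Sprung's Thm. 5.1 `b_{m_-} = −(a_{m_-}/2)(log_γ N − 1/(p+1) + m_-)` (Kobayashi's `+` is Pollack's `−`).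
[cite: Sprung2017, Cor. 4.14 (a_p = 0 display)] [cite: MazurTateTeitelbaum1986Invent, §I.17] [cite: Kobayashi2003, Thm. 3.2, (3.4)] -/
theorem two_mul_coeff_succ_order_add_eq_zero_of_isQuadraticBranchPlusLFunction (hp2 : p ≠ 2) (hf0 : IsNewform0 f)
    (hQ : coeffField f = ⊥) (hpN : ¬ p ∣ N) (hap : cuspCoeff f p = ((0 : ℤ) : ℂ))
    {ηN : rootsOfUnity (torsionOrder p) ℤ_[p]} {c : ℤ_[p]}
    (hc : ∀ n : ℕ, PadicInt.toZModPow (n + cyclotomicExponent p) ((ηN : ℤ_[p]ˣ) : ℤ_[p]) *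
      (cyclotomicGenerator p : ZMod (p ^ (n + cyclotomicExponent p))) ^ (PadicInt.toZModPow n c).val =
        (N : ZMod (p ^ (n + cyclotomicExponent p))))
    {b : ℤ_[p]} (hb : ((p : ℤ_[p]) + 1) * b = -1)
    {ϖ : ℚ} {L : IwasawaAlgebra p} (hL : IsQuadraticBranchPlusLFunction f p ϖ L) (hL0 : L ≠ 0) :
    2 * PowerSeries.coeff (L.order.toNat + 1) L + (c + b + L.order.toNat) * PowerSeries.coeff L.order.toNat L = 0 := by
  obtain ⟨σ, hσ, hW⟩ := exists_frickeSign_of_isNewform0 hf0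
  exact two_mul_coeff_succ_order_add_eq_zero_of_invol_eq hL0
    (invol_eq_of_isQuadraticBranchPlusLFunction hp2 hf0 hQ hpN hap hσ hW hc hb hL)

/-- **THE SUB-LEADING TERM LAW FOR `L_p⁻(V, η, X)`** (exponent `c + a`, `(p+1)a = −p`): `2·coeff_{r+1} L + (c + a + r)·coeff_r L = 0`, `r = ord_T L`.
[cite: Sprung2017, Cor. 4.14 (a_p = 0 display)] [cite: MazurTateTeitelbaum1986Invent, §I.17] [cite: Kobayashi2003, Thm. 3.2, (3.5)] -/
theorem two_mul_coeff_succ_order_add_eq_zero_of_isQuadraticBranchMinusLFunction (hp2 : p ≠ 2) (hf0 : IsNewform0 f)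
    (hQ : coeffField f = ⊥) (hpN : ¬ p ∣ N) (hap : cuspCoeff f p = ((0 : ℤ) : ℂ))
    {ηN : rootsOfUnity (torsionOrder p) ℤ_[p]} {c : ℤ_[p]}
    (hc : ∀ n : ℕ, PadicInt.toZModPow (n + cyclotomicExponent p) ((ηN : ℤ_[p]ˣ) : ℤ_[p]) *
      (cyclotomicGenerator p : ZMod (p ^ (n + cyclotomicExponent p))) ^ (PadicInt.toZModPow n c).val =
        (N : ZMod (p ^ (n + cyclotomicExponent p))))
    {a : ℤ_[p]} (ha : ((p : ℤ_[p]) + 1) * a = -(p : ℤ_[p]))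
    {ϖ : ℚ} {L : IwasawaAlgebra p} (hL : IsQuadraticBranchMinusLFunction f p ϖ L) (hL0 : L ≠ 0) :
    2 * PowerSeries.coeff (L.order.toNat + 1) L + (c + a + L.order.toNat) * PowerSeries.coeff L.order.toNat L = 0 := by
  obtain ⟨σ, hσ, hW⟩ := exists_frickeSign_of_isNewform0 hf0
  exact two_mul_coeff_succ_order_add_eq_zero_of_invol_eq hL0
    (invol_eq_of_isQuadraticBranchMinusLFunction hp2 hf0 hQ hpN hap hσ hW hc ha hL)

/-- **The cyclotomic derivative at `X = 0` is determined by the value**: if `L_p⁺(V, η, 0) ≠ 0` then `2·coeff₁ L = −(c + b)·L(0)`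
(`c = log_γ⟨N⟩`, `b = −1/(p+1)`). [cite: Sprung2017, Cor. 4.14 (a_p = 0 display)] [cite: MazurTateTeitelbaum1986Invent, §I.17] -/
theorem two_mul_coeff_one_eq_of_isQuadraticBranchPlusLFunction (hp2 : p ≠ 2) (hf0 : IsNewform0 f)
    (hQ : coeffField f = ⊥) (hpN : ¬ p ∣ N) (hap : cuspCoeff f p = ((0 : ℤ) : ℂ))
    {ηN : rootsOfUnity (torsionOrder p) ℤ_[p]} {c : ℤ_[p]}
    (hc : ∀ n : ℕ, PadicInt.toZModPow (n + cyclotomicExponent p) ((ηN : ℤ_[p]ˣ) : ℤ_[p]) *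
      (cyclotomicGenerator p : ZMod (p ^ (n + cyclotomicExponent p))) ^ (PadicInt.toZModPow n c).val =
        (N : ZMod (p ^ (n + cyclotomicExponent p))))
    {b : ℤ_[p]} (hb : ((p : ℤ_[p]) + 1) * b = -1)
    {ϖ : ℚ} {L : IwasawaAlgebra p} (hL : IsQuadraticBranchPlusLFunction f p ϖ L)
    (h0 : PowerSeries.constantCoeff L ≠ 0) :
    2 * PowerSeries.coeff 1 L = -(c + b) * PowerSeries.constantCoeff L := by
  have hL0 : L ≠ 0 := fun h ↦ h0 (by rw [h, map_zero])
  have hord : L.order = ((0 : ℕ) : ℕ∞) := by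
    rw [PowerSeries.order_eq_nat]
    exact ⟨by rwa [PowerSeries.coeff_zero_eq_constantCoeff], fun i hi ↦ (Nat.not_lt_zero i hi).elim⟩
  have h := two_mul_coeff_succ_order_add_eq_zero_of_isQuadraticBranchPlusLFunction hp2 hf0 hQ hpN hap hc hb hL hL0
  have hr : L.order.toNat = 0 := by rw [hord]; rfl
  rw [hr, zero_add, Nat.cast_zero, add_zero, PowerSeries.coeff_zero_eq_constantCoeff] at h
  linear_combination h

end Branch

/-! ### Row currency (the crux's rows: `V` good at `p ≥ 5`, `a_p(V) = 0`; hypothesis-free beyond the row data) -/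

section Row

variable {N : ℕ} [NeZero N] {f : CuspForm (Gamma0 N) 2}

/-- **THE SUB-LEADING TERM LAW AT A ROW (plus).** `V` globally minimal, good at `p ≥ 5`, `a_p(V) = 0` (every row of crux 19606), `f` its newform of
any level `N`, `c` the `p`-adic exponent of `N`, `(p+1)b = −1`; every NONZERO plus branch function `Lη`, any period ratio, `r = ord_T Lη`:
`2·coeff_{r+1} Lη + (c + b + r)·coeff_r Lη = 0`. [cite: Sprung2017, Cor. 4.14 (a_p = 0 display)] [cite: MazurTateTeitelbaum1986Invent, §I.17] -/
theorem two_mul_coeff_succ_order_add_eq_zero_plus_row (hp5 : 5 ≤ p) (V : WeierstrassCurve ℚ) [V.IsElliptic] [V.IsGloballyMinimal]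
    (hgood : V.HasGoodReductionAtPrime p) (hap : V.frobeniusTrace p = 0) (hf : IsNewformOf V f)
    {ηN : rootsOfUnity (torsionOrder p) ℤ_[p]} {c : ℤ_[p]}
    (hc : ∀ n : ℕ, PadicInt.toZModPow (n + cyclotomicExponent p) ((ηN : ℤ_[p]ˣ) : ℤ_[p]) *
      (cyclotomicGenerator p : ZMod (p ^ (n + cyclotomicExponent p))) ^ (PadicInt.toZModPow n c).val =
        (N : ZMod (p ^ (n + cyclotomicExponent p))))
    {b : ℤ_[p]} (hb : ((p : ℤ_[p]) + 1) * b = -1)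
    (ϖ : ℚ) {Lη : IwasawaAlgebra p} (hL : IsQuadraticBranchPlusLFunction f p ϖ Lη) (hL0 : Lη ≠ 0) :
    2 * PowerSeries.coeff (Lη.order.toNat + 1) Lη + (c + b + Lη.order.toNat) * PowerSeries.coeff Lη.order.toNat Lη = 0 := by
  have hp2 : p ≠ 2 := by omega
  have hap' : cuspCoeff f p = ((0 : ℤ) : ℂ) := by
    rw [cuspCoeff_eq_frobeniusTrace_of_isNewformOf_holds hf hgood, hap]
  exact two_mul_coeff_succ_order_add_eq_zero_of_isQuadraticBranchPlusLFunction hp2 hf.1 hf.coeffField_eq_bot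
    (not_dvd_level_of_isNewformOf hf hgood) hap' hc hb hL hL0

/-- **THE SUB-LEADING TERM LAW AT A ROW (minus)**: `2·coeff_{r+1} Lη + (c + a + r)·coeff_r Lη = 0`, `(p+1)a = −p`.
[cite: Sprung2017, Cor. 4.14 (a_p = 0 display)] [cite: MazurTateTeitelbaum1986Invent, §I.17] -/
theorem two_mul_coeff_succ_order_add_eq_zero_minus_row (hp5 : 5 ≤ p) (V : WeierstrassCurve ℚ) [V.IsElliptic] [V.IsGloballyMinimal]
    (hgood : V.HasGoodReductionAtPrime p) (hap : V.frobeniusTrace p = 0) (hf : IsNewformOf V f)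
    {ηN : rootsOfUnity (torsionOrder p) ℤ_[p]} {c : ℤ_[p]}
    (hc : ∀ n : ℕ, PadicInt.toZModPow (n + cyclotomicExponent p) ((ηN : ℤ_[p]ˣ) : ℤ_[p]) *
      (cyclotomicGenerator p : ZMod (p ^ (n + cyclotomicExponent p))) ^ (PadicInt.toZModPow n c).val =
        (N : ZMod (p ^ (n + cyclotomicExponent p))))
    {a : ℤ_[p]} (ha : ((p : ℤ_[p]) + 1) * a = -(p : ℤ_[p]))
    (ϖ : ℚ) {Lη : IwasawaAlgebra p} (hL : IsQuadraticBranchMinusLFunction f p ϖ Lη) (hL0 : Lη ≠ 0) :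
    2 * PowerSeries.coeff (Lη.order.toNat + 1) Lη + (c + a + Lη.order.toNat) * PowerSeries.coeff Lη.order.toNat Lη = 0 := by
  have hp2 : p ≠ 2 := by omega
  have hap' : cuspCoeff f p = ((0 : ℤ) : ℂ) := by
    rw [cuspCoeff_eq_frobeniusTrace_of_isNewformOf_holds hf hgood, hap]
  exact two_mul_coeff_succ_order_add_eq_zero_of_isQuadraticBranchMinusLFunction hp2 hf.1 hf.coeffField_eq_bot
    (not_dvd_level_of_isNewformOf hf hgood) hap' hc ha hL hL0

/-- **AT A ROW: `L_p⁺(V, η, 0) ≠ 0 ⇒ 2·coeff₁ Lη = −(c + b)·Lη(0)`** (the value fixes the cyclotomic derivative).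
[cite: Sprung2017, Cor. 4.14 (a_p = 0 display)] [cite: MazurTateTeitelbaum1986Invent, §I.17] -/
theorem two_mul_coeff_one_eq_plus_row (hp5 : 5 ≤ p) (V : WeierstrassCurve ℚ) [V.IsElliptic] [V.IsGloballyMinimal]
    (hgood : V.HasGoodReductionAtPrime p) (hap : V.frobeniusTrace p = 0) (hf : IsNewformOf V f)
    {ηN : rootsOfUnity (torsionOrder p) ℤ_[p]} {c : ℤ_[p]}
    (hc : ∀ n : ℕ, PadicInt.toZModPow (n + cyclotomicExponent p) ((ηN : ℤ_[p]ˣ) : ℤ_[p]) *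
      (cyclotomicGenerator p : ZMod (p ^ (n + cyclotomicExponent p))) ^ (PadicInt.toZModPow n c).val =
        (N : ZMod (p ^ (n + cyclotomicExponent p))))
    {b : ℤ_[p]} (hb : ((p : ℤ_[p]) + 1) * b = -1)
    (ϖ : ℚ) {Lη : IwasawaAlgebra p} (hL : IsQuadraticBranchPlusLFunction f p ϖ Lη) (h0 : PowerSeries.constantCoeff Lη ≠ 0) :
    2 * PowerSeries.coeff 1 Lη = -(c + b) * PowerSeries.constantCoeff Lη := by
  have hp2 : p ≠ 2 := by omega
  have hap' : cuspCoeff f p = ((0 : ℤ) : ℂ) := by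
    rw [cuspCoeff_eq_frobeniusTrace_of_isNewformOf_holds hf hgood, hap]
  exact two_mul_coeff_one_eq_of_isQuadraticBranchPlusLFunction hp2 hf.1 hf.coeffField_eq_bot
    (not_dvd_level_of_isNewformOf hf hgood) hap' hc hb hL h0

end Row

end Summit.BirchSwinnertonDyer.BirchSwinnertonDyer.Theorems.EtaThetaFunctionalEquation

end
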